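import Summits.BirchSwinnertonDyer.BirchSwinnertonDyer.Theorems.PAdicOrderV2PadicBSDrankOrderEqCorankOdd
import Summits.BirchSwinnertonDyer.BirchSwinnertonDyer.Theorems.PAdicOrderV2PadicBSDrankRankEqCorankOfShaFinite

/-!
# BirchSwinnertonDyer / PAdicOrderV2 — crux `PAdicOrderPadicBSDrankR2` (stmt-0490), line `Sketch`:
# anatomy of the `p = 2` residue (helper, `--supports`; does NOT close the stub)

The registered stub `stub_padicBSDrank_residueTwo` of `Cruxes/PAdicOrderPadicBSDrankR2/Lines/Sketch.lean`
(v3) is the crux at `p = 2` above level `0`: for `E/ℚ` (globally minimal `W`) good ordinary at `2`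
and the newform `f` of `E`, `1 ≤ ord_{T=0} L_2(E,T) ⇒ ord_{T=0} L_2(E,T) = rank E(ℚ)`. No printed
theorem feeds it: Kato's divisibility (`kato_divisibility`) and the main-conjecture items
`PAdicOrderMainConjectureR5/R7` carry `p ≠ 2` / `5 ≤ p` / `3 ≤ p`, the semisimplicity item
`PAdicOrderSemisimpleR3` carries `p ≠ 2`.

This file kernel-checks that the `p = 2` residue has EXACTLY THE SAME SHAPE as the odd-`p` case of
the line — nothing in the tree's algebra or in the cyclotomic setting needs `p` odd:

* `padicBSDrank_residueTwo_of_conjectures` — for a prime `p` (ANY `p`, in particular `p = 2`), a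
  curve `E/ℚ` good ordinary at `p` with newform `f`: IF Mazur's main conjecture holds at `(E,p)` in
  `Λ ⊗ ℚ_p` for the cyclotomic data matching the variable (the body of item stmt-15426 at this `p`),
  `T` acts semisimply on `X(E/ℚ_∞)` at `T = 0` (the body of item stmt-0509 at this `p`), Mazur's
  control identity holds at `(E,p)` and `Ш(E/ℚ)[p^∞]` is finite, THEN `ord_{T=0} L_p(E,T) = rank E(ℚ)`.
  The proof is the odd-`p` proof verbatim (`exists_isCyclotomic_isTopGenerator_isCyclotomicVariable_holds`,
  `nonempty_selmerDualData_holds`, the landed `stub_ker_mulTRat_sq_eq`, `stub_order_eq_selmerCorank`,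
  `stub_padicBSDrank_rankEqCorankOfShaFinite`).

So the `p = 2` residue of the crux is precisely "items stmt-15426 and stmt-0509 with their parity
guards dropped, at `p = 2`" plus `Ш[2^∞]`-finiteness (item stmt-0132 at `p = 2`) and control — all
beyond print at `p = 2` (Mazur–Tate–Teitelbaum 1986 §II.10 state BSD(`p`) for every good ordinary
`p`; the Euler-system input stops at `p` odd). Route kill criterion (c) classifies a failure at
`p = 2` as MISSTATED (repair `p ≠ 2 →`).
-/

-- D-0017: single-problem summit, so `Summit.BirchSwinnertonDyer.BirchSwinnertonDyer.…` repeats a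
-- namespace BY DESIGN.
set_option linter.dupNamespace false

namespace Summit.BirchSwinnertonDyer.BirchSwinnertonDyer.Theorems

open scoped MatrixGroups ModularForm TensorProduct
open CongruenceSubgroup Literature.NumberTheory.EllipticCurves
  Literature.NumberTheory.EllipticCurves.ModularForms
  Literature.NumberTheory.EllipticCurves.IwasawaAlgebra

/-- **The crux at one prime from the main conjecture, semisimplicity, control and `Ш` at that
prime — for ANY prime `p`, `p = 2` included.** Let `E/ℚ` (globally minimal `W`) be good ordinary
at the prime `p`, `f` a newform of `E`. Assume, at this `(E,p)`: (MC) for every cyclotomic `κ` with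
topological generator `γ` matching the variable and every dual datum `D`, `X = D.X` is torsion and
`char_Λ X = (g)` with `ι g = p^k · L_p(E,T)`; (SS) for every cyclotomic `κ, γ` and `D`, `T` acts
semisimply on `X` at `T = 0` (`p^k T² x = 0 ⇒ p^{k'} T x = 0`); (CT) `rank_{ℤ_p} X/TX = corank_{ℤ_p}
Sel_{p^∞}(E/ℚ)` for every cyclotomic `κ, γ, D`; (Ш) `Ш(E/ℚ)[p^∞]` is finite. Then
`ord_{T=0} L_p(E,T) = rank E(ℚ)`. At `p = 2` this is the registered stub
`stub_padicBSDrank_residueTwo` made transparent: its open content is (MC) ∧ (SS) at `p = 2` (items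
stmt-15426 / stmt-0509 without their parity guards) ∧ (Ш) (item stmt-0132 at `2`) ∧ (CT).
[cite: MazurTateTeitelbaum1986Invent, §II.10] [cite: GreenbergLNM1716, §1 Conj. 1.12–1.13 and p. 65] -/
theorem padicBSDrank_residueTwo_of_conjectures : ∀ (W : WeierstrassCurve ℚ) [W.IsElliptic]
    [W.IsGloballyMinimal] (p : ℕ) [Fact p.Prime],
    Literature.NumberTheory.EllipticCurves.IsOrdinaryAt W p →
    ∀ {N : ℕ} [NeZero N] (f : CuspForm (CongruenceSubgroup.Gamma0 N) 2),
    Literature.NumberTheory.EllipticCurves.ModularForms.IsNewformOf W f →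
    (∀ (κ : Literature.NumberTheory.EllipticCurves.ZpExtension ℚ p) (γ : Field.absoluteGaloisGroup ℚ),
      κ.IsCyclotomic → κ.IsTopGenerator γ →
      Literature.NumberTheory.EllipticCurves.IsCyclotomicVariable p γ →
      ∀ (D : W.SelmerDualData κ γ), D.IsTorsion ∧
        ∃ (g : Literature.NumberTheory.EllipticCurves.IwasawaAlgebra p) (k : ℤ),
          D.charIdeal = Ideal.span {g} ∧
          Literature.NumberTheory.EllipticCurves.iwasawaToPowerSeries p g =
            PowerSeries.C ((p : ℚ_[p]) ^ k) *
              Literature.NumberTheory.EllipticCurves.padicLFunction f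
                (Literature.NumberTheory.EllipticCurves.unitRoot W p : ℚ_[p])) →
    (∀ (κ : Literature.NumberTheory.EllipticCurves.ZpExtension ℚ p) (γ : Field.absoluteGaloisGroup ℚ),
      κ.IsCyclotomic → κ.IsTopGenerator γ → ∀ (D : W.SelmerDualData κ γ) (x : D.X),
      (∃ k : ℕ, (PowerSeries.C ((p : ℤ_[p]) ^ k) * PowerSeries.X ^ 2 :
          Literature.NumberTheory.EllipticCurves.IwasawaAlgebra p) • x = 0) →
        ∃ k : ℕ, (PowerSeries.C ((p : ℤ_[p]) ^ k) * PowerSeries.X :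
          Literature.NumberTheory.EllipticCurves.IwasawaAlgebra p) • x = 0) →
    (∀ (κ : Literature.NumberTheory.EllipticCurves.ZpExtension ℚ p) (γ : Field.absoluteGaloisGroup ℚ),
      κ.IsCyclotomic → κ.IsTopGenerator γ → ∀ (D : W.SelmerDualData κ γ),
      Literature.NumberTheory.EllipticCurves.IwasawaAlgebra.coinvariantsRank p D.X = W.selmerCorank p) →
    Finite (AddCommGroup.primaryComponent W.sha p) →
    (Literature.NumberTheory.EllipticCurves.padicLFunction f
      (Literature.NumberTheory.EllipticCurves.unitRoot W p : ℚ_[p])).order = W.mordellWeilRank := by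
  intro W _ _ p _ hord N _ f hf hMC hSS hCT hsha
  -- the cyclotomic datum matching the variable `T`, and a Pontryagin-dual datum `D` (any prime `p`)
  obtain ⟨κ, hκ, γ, hγ, hγ'⟩ := exists_isCyclotomic_isTopGenerator_isCyclotomicVariable_holds p
  obtain ⟨D⟩ := W.nonempty_selmerDualData_holds κ γ hγ
  obtain ⟨htors, hmc⟩ := hMC κ γ hκ hγ hγ' D
  have hss := stub_ker_mulTRat_sq_eq p D.X (hSS κ γ hκ hγ D)
  -- `ord_T L_p = corank Sel_{p^∞}` (landed bookkeeping) `= rank` (Ш finite)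
  rw [stub_order_eq_selmerCorank W p κ γ hκ hγ f D htors hmc hss (hCT κ γ hκ hγ D),
    stub_padicBSDrank_rankEqCorankOfShaFinite W p hsha]

end Summit.BirchSwinnertonDyer.BirchSwinnertonDyer.Theorems
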